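import Mathlib
import Summits.ValiantsHypothesis.ValiantsHypothesis.Theorems.LacunarySymmetroidMatrixDescartesDoorA26WallBubblingBubblingDefs

/-!
# Inertia `≤ (1,2)` ⇒ symmetroid Gram shape (B11, spectral half) — turnkey helper, val-idea-15

Module of the BUBBLING REDUCTION for obligation (B) `Stmt.stub_bubbling` of the line `Cruxes/DoorA26/Lines/wall_bubbling.lean`
(stmt-ValiantsHypothesis-19979, `Theses.LacunarySymmetroid.DoorA26`).  Contents: `entry_eq_sum_eigen` / `dot_eigen` / `quad_eigen` (the real spectral theorem in coordinates), `isSymGram_of_small_sums`,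
`isSymGram_of_inertia` (a real symmetric matrix with `n₊ ≤ 1`, `n₋ ≤ 2` is `v vᵀ − u uᵀ − w wᵀ`). [this work]

HONEST FRAMING / PROVENANCE.  Turnkey port of ideator val-idea-15 g1 (crux workfile `Cruxes/DoorA26/Lines/wall_bubbling_Assembly.lean`, commit d4cb61350496, ZERO `sorry`; split into ≤ 400-line modules, one
namespace `…WallBubbling.Bubbling`, single copies of the definitions), filed by prover seat val-port-4 g1 (val-lit port pool; desk g12 RULING #266 (b), director R166/R168) with `--supports stmt-ValiantsHypothesis-19979 --as helper`.
Mathlib-only mathematics (elementary real analysis, linear algebra, finite combinatorics); nothing here bears on `DoorA26` (OPEN; obligations (W), (M), (R) of the line remain),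
on `MatrixDescartes` (stmt-ValiantsHypothesis-18050) or on `VP ≠ VNP`.
-/

-- `Summit.ValiantsHypothesis.ValiantsHypothesis.…` repeats a component by the D-0017 layout
-- (single-conjunct summit), which the `dupNamespace` linter flags; the name is mandated.
set_option linter.dupNamespace false

namespace Summit.ValiantsHypothesis.ValiantsHypothesis.Theorems.LacunarySymmetroidMatrixDescartes.WallBubbling.Bubbling

/-! # Part V — inertia and the closed realisable cone (B11; workfile `Lines/wall_bubbling_Inertia.lean`) -/


open Matrix Finset

variable {n : Type*} [Fintype n] [DecidableEq n]




/-! ## The real spectral theorem in coordinates -/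

omit [Fintype n] [DecidableEq n] in
/-- A real symmetric matrix is Hermitian. [this work] -/
theorem isHermitian_of_isSymm {M : Matrix n n ℝ} (hM : M.IsSymm) : M.IsHermitian := by
  show Mᴴ = M
  rw [Matrix.conjTranspose_eq_transpose_of_trivial]
  exact hM

/-- Entrywise spectral expansion `M a b = ∑ i, λ i · u i a · u i b`. [folklore] -/
theorem entry_eq_sum_eigen {M : Matrix n n ℝ} (hH : M.IsHermitian) (a b : n) :
    M a b = ∑ i, hH.eigenvalues i * ((⇑(hH.eigenvectorBasis i)) a * (⇑(hH.eigenvectorBasis i)) b) := by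
  have h := hH.spectral_theorem
  rw [Unitary.conjStarAlgAut_apply] at h
  conv_lhs => rw [h]
  rw [Matrix.mul_apply]
  simp only [Matrix.mul_apply, Matrix.diagonal_apply, Matrix.star_apply, Matrix.IsHermitian.eigenvectorUnitary_apply,
    Function.comp_apply, star_trivial, mul_ite, mul_zero, Finset.sum_ite_eq', Finset.mem_univ, if_true]
  refine Finset.sum_congr rfl fun i _ => ?_
  simp only [RCLike.ofReal_real_eq_id, id_eq]
  ring

/-- Orthonormality of the eigenvector basis in `dotProduct` form. [folklore] -/
theorem dot_eigen {M : Matrix n n ℝ} (hH : M.IsHermitian) (i j : n) :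
    (⇑(hH.eigenvectorBasis i)) ⬝ᵥ (⇑(hH.eigenvectorBasis j)) = if i = j then 1 else 0 := by
  have h := (orthonormal_iff_ite.mp hH.eigenvectorBasis.orthonormal) i j
  rw [EuclideanSpace.inner_eq_star_dotProduct, star_trivial, dotProduct_comm] at h
  exact_mod_cast h

/-- The quadratic form is diagonal in the eigenvector basis. [folklore] -/
theorem quad_eigen {M : Matrix n n ℝ} (hH : M.IsHermitian) (i j : n) :
    (⇑(hH.eigenvectorBasis i)) ⬝ᵥ (M *ᵥ ⇑(hH.eigenvectorBasis j)) = if i = j then hH.eigenvalues j else 0 := by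
  rw [hH.mulVec_eigenvectorBasis j, dotProduct_smul, dot_eigen hH i j]
  split_ifs <;> simp

/-! ## Padding small sums of rank-one terms -/

omit [Fintype n] in
/-- A sum of at most one rank-one square minus a sum of at most two is of symmetroid Gram shape. [folklore] -/
theorem isSymGram_of_small_sums (f g : n → n → ℝ) (P N : Finset n) (hP : P.card ≤ 1) (hN : N.card ≤ 2) :
    ∃ v u w : n → ℝ, (∑ i ∈ P, vecMulVec (f i) (f i)) - ∑ i ∈ N, vecMulVec (g i) (g i) =
      vecMulVec v v - vecMulVec u u - vecMulVec w w := by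
  -- the positive part
  have hPsum : ∃ v : n → ℝ, ∑ i ∈ P, vecMulVec (f i) (f i) = vecMulVec v v := by
    rcases Nat.le_one_iff_eq_zero_or_eq_one.mp hP with h0 | h1
    · refine ⟨0, ?_⟩
      rw [Finset.card_eq_zero.mp h0, Finset.sum_empty]
      ext a b
      simp
    · obtain ⟨p, rfl⟩ := Finset.card_eq_one.mp h1
      exact ⟨f p, by rw [Finset.sum_singleton]⟩
  -- the negative part
  have hNsum : ∃ u w : n → ℝ, ∑ i ∈ N, vecMulVec (g i) (g i) = vecMulVec u u + vecMulVec w w := by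
    have hN' : N.card = 0 ∨ N.card = 1 ∨ N.card = 2 := by omega
    rcases hN' with h0 | h1 | h2
    · refine ⟨0, 0, ?_⟩
      rw [Finset.card_eq_zero.mp h0, Finset.sum_empty]
      ext a b
      simp
    · obtain ⟨q, rfl⟩ := Finset.card_eq_one.mp h1
      refine ⟨g q, 0, ?_⟩
      rw [Finset.sum_singleton]
      ext a b
      simp
    · obtain ⟨q, r, hqr, rfl⟩ := Finset.card_eq_two.mp h2
      exact ⟨g q, g r, by rw [Finset.sum_pair hqr]⟩
  obtain ⟨v, hv⟩ := hPsum
  obtain ⟨u, w, huw⟩ := hNsum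
  exact ⟨v, u, w, by rw [hv, huw, sub_add_eq_sub_sub]⟩

/-! ## B11 (spectral half): inertia `≤ (1,2)` ⇒ symmetroid Gram shape -/

omit [DecidableEq n] in
/-- **B11, spectral half.**  A real symmetric matrix with `n₊ ≤ 1` and `n₋ ≤ 2` (witness-style negations) is of the shape
`v vᵀ − u uᵀ − w wᵀ`. [folklore: spectral theorem] -/
theorem isSymGram_of_inertia (M : Matrix n n ℝ) (hM : M.IsSymm) (h2 : ¬ TwoPos M) (h3 : ¬ ThreeNeg M) :
    IsSymGram M := by
  classical
  have hH : M.IsHermitian := isHermitian_of_isSymm hM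
  set lam : n → ℝ := hH.eigenvalues with hlam
  set u : n → n → ℝ := fun i => ⇑(hH.eigenvectorBasis i) with hu
  have hquad : ∀ i j, u i ⬝ᵥ (M *ᵥ u j) = if i = j then lam j else 0 := fun i j => quad_eigen hH i j
  -- at most one positive eigenvalue
  set P : Finset n := Finset.univ.filter fun i => 0 < lam i with hPdef
  set N : Finset n := Finset.univ.filter fun i => lam i < 0 with hNdef
  have hPcard : P.card ≤ 1 := by
    by_contra hc
    obtain ⟨i, j, hi, hj, hij⟩ := (Finset.one_lt_card_iff (s := P)).mp (by omega)
    have hi' : 0 < lam i := (Finset.mem_filter.mp hi).2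
    have hj' : 0 < lam j := (Finset.mem_filter.mp hj).2
    apply h2
    refine ⟨u i, u j, ?_, ?_, ?_⟩
    · rw [hquad, if_pos rfl]; exact hi'
    · rw [hquad, if_pos rfl]; exact hj'
    · rw [hquad, if_neg hij]
  have hNcard : N.card ≤ 2 := by
    by_contra hc
    obtain ⟨i, j, k, hi, hj, hk, hij, hik, hjk⟩ := (Finset.two_lt_card_iff (s := N)).mp (by omega)
    have hi' : lam i < 0 := (Finset.mem_filter.mp hi).2
    have hj' : lam j < 0 := (Finset.mem_filter.mp hj).2
    have hk' : lam k < 0 := (Finset.mem_filter.mp hk).2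
    apply h3
    refine ⟨u i, u j, u k, ?_, ?_, ?_, ?_, ?_, ?_⟩
    · rw [hquad, if_pos rfl]; exact hi'
    · rw [hquad, if_pos rfl]; exact hj'
    · rw [hquad, if_pos rfl]; exact hk'
    · rw [hquad, if_neg hij]
    · rw [hquad, if_neg hik]
    · rw [hquad, if_neg hjk]
  -- the rank-one expansion split by sign
  set f : n → n → ℝ := fun i => Real.sqrt (lam i) • u i with hf
  set g : n → n → ℝ := fun i => Real.sqrt (-lam i) • u i with hg
  have hM_eq : M = (∑ i ∈ P, vecMulVec (f i) (f i)) - ∑ i ∈ N, vecMulVec (g i) (g i) := by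
    ext a b
    rw [entry_eq_sum_eigen hH a b, Matrix.sub_apply, Matrix.sum_apply, Matrix.sum_apply, hPdef, hNdef,
      Finset.sum_filter, Finset.sum_filter, ← Finset.sum_sub_distrib]
    refine Finset.sum_congr rfl fun i _ => ?_
    have key : lam i * (u i a * u i b) =
        (if 0 < lam i then f i a * f i b else 0) - (if lam i < 0 then g i a * g i b else 0) := by
      simp only [hf, hg, Pi.smul_apply, smul_eq_mul]
      rcases lt_trichotomy (lam i) 0 with hneg | hzero | hpos
      · rw [if_neg (not_lt.mpr hneg.le), if_pos hneg]
        have hs : Real.sqrt (-lam i) * Real.sqrt (-lam i) = -lam i := Real.mul_self_sqrt (by linarith)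
        have hr : Real.sqrt (-lam i) * u i a * (Real.sqrt (-lam i) * u i b)
            = (Real.sqrt (-lam i) * Real.sqrt (-lam i)) * (u i a * u i b) := by ring
        rw [hr, hs]
        ring
      · rw [if_neg (by rw [hzero]; exact lt_irrefl 0), if_neg (by rw [hzero]; exact lt_irrefl 0), hzero]
        ring
      · rw [if_pos hpos, if_neg (not_lt.mpr hpos.le)]
        have hs : Real.sqrt (lam i) * Real.sqrt (lam i) = lam i := Real.mul_self_sqrt hpos.le
        have hr : Real.sqrt (lam i) * u i a * (Real.sqrt (lam i) * u i b)
            = (Real.sqrt (lam i) * Real.sqrt (lam i)) * (u i a * u i b) := by ring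
        rw [hr, hs]
        ring
    simp only [vecMulVec_apply]
    exact key
  obtain ⟨v, u', w, hvuw⟩ := isSymGram_of_small_sums f g P N hPcard hNcard
  exact ⟨v, u', w, by rw [hM_eq, hvuw]⟩

end Summit.ValiantsHypothesis.ValiantsHypothesis.Theorems.LacunarySymmetroidMatrixDescartes.WallBubbling.Bubbling
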